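import Summits.KontsevichZagierPeriods.KontsevichZagierPeriods.Theorems.HeckeMultiplicityOneManinStokesTiles

/-!
# `ManinStokes` (stmt-KontsevichZagierPeriods-5277, route `HeckeMultiplicityOne`): Manin's three-term
# relation for the modular-symbol classes `classRe`, `classIm`, modulo the six per-tile Cauchy relations

Support file (prover-owned, `--supports stmt-KontsevichZagierPeriods-5277`); the specialisation of the
part-generic reduction `three_term_of_tiles` of `HeckeMultiplicityOneManinStokesTiles.lean` to the canonical
half-arc representations of `Literature/NumberTheory/EllipticCurves/ModularSymbolRep.lean`:
for a weight-two cusp form `f` on `Γ₀(N)`, `g ∈ SL₂(ℤ)`, `R = TS` and `ρ₀ : ModularSymbolRep f g`,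
`ρ₁ : ModularSymbolRep f (gR)`, `ρ₂ : ModularSymbolRep f (gR²)`,

  `ρ₀.classRe + ρ₁.classRe + ρ₂.classRe ∈ KZ.relations`  and  `ρ₀.classIm + ρ₁.classIm + ρ₂.classIm ∈ KZ.relations`

(the typed content of the informal item: `[{g0,g∞}] + [{g∞,g1}] + [{g1,g0}] ∈ KZ.relations`, real and
imaginary parts) FOLLOW from the per-tile Cauchy relations of the six `(2,3,∞)`-tiles `gR^k τ₀`, `gR^k S τ₀*`
of the ideal triangle `g·(0, ∞, 1)` in the algebraic coordinate `u = j` (hypotheses `hP₀ … hM₂`; see the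
module docstring of the `Tiles` file for the mechanism and the edge bookkeeping). The two-term relation
`[{α,β}] + [{β,α}]` needs no move at all: `ModularSymbolRep.classRe_add_classRe_mul_S` (it is `0` in `FormalRep`).

References: Ju. I. Manin, *Parabolic points and zeta functions of modular curves* (1972), §1.5–1.6;
J. E. Cremona, *Algorithms for modular elliptic curves* (1997), §2.1 (2.1.4)–(2.1.5).
No definitions, no named facts.
-/

noncomputable section

open scoped MatrixGroups ModularForm
open CongruenceSubgroup Complex MeasureTheory Set
open UpperHalfPlane hiding I
open Literature.NumberTheory.EllipticCurves.ModularForms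
open Literature.NumberTheory.Transcendental Literature.NumberTheory.Transcendental.KZ

namespace Summit.KontsevichZagierPeriods.HeckeMultiplicityOne.ManinStokes

variable {N : ℕ}

/-! ### The three-term relation for the modular-symbol classes, modulo the tile relations -/

/-- **Manin's three-term relation for `classRe`, reduced to the six per-tile Cauchy relations.**
For a weight-two cusp form `f` on `Γ₀(N)`, `g ∈ SL₂(ℤ)`, `R = TS`, and modular-symbol representations
`ρ₀, ρ₁, ρ₂` of `⟨g⟩_f, ⟨gR⟩_f, ⟨gR²⟩_f` (`ModularSymbolRep`; for `f` with rational coefficients they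
exist for every `g`, `ModularSymbolRep.of_hasRatCoeffs`): IF each of the six tiles `gR^k τ₀`, `gR^k S τ₀*`
of the ideal triangle `g·(0, ∞, 1)` carries edge representations over `(1728,∞)`, `(0,1728)`, `(−∞,0)`
with integrands the real parts of `(ω_f/dj)` along its three edges (edge parametrisations `ζB`, `ζC` of
the interior edges of `τ₀` by `u = j`, and `S ∘ ζB`, `T⁻¹ ∘ ζC` for `τ₀*`) whose formal sum lies in
`KZ.relations` (Cauchy's theorem for the tile inside the calculus), THEN
`ρ₀.classRe + ρ₁.classRe + ρ₂.classRe ∈ KZ.relations`. Specialisation of `three_term_of_tiles` to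
`ℓ = re` and the canonical half-arc representations. [cite: Manin1972, §1.6] -/
theorem classRe_three_term_of_tiles (f : CuspForm (Gamma0 N) 2) (g : SL(2, ℤ)) (ζB ζC : ℝ → ℍ)
    (ρ₀ : ModularSymbolRep f g) (ρ₁ : ModularSymbolRep f (g * (ModularGroup.T * ModularGroup.S)))
    (ρ₂ : ModularSymbolRep f
      (g * (ModularGroup.T * ModularGroup.S) * (ModularGroup.T * ModularGroup.S)))
    (hP₀ : ∃ a b c : IntegralRep 1,
      a.domain = arcDomain ∧
      EqOn a.integrand (fun x => (arcIntegrand (⇑f ∣[(2 : ℤ)] g) (x 0)).re) arcDomain ∧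
      b.domain = {x | x 0 ∈ Ioo (0 : ℝ) 1728} ∧
      EqOn b.integrand (fun x => (djQuot (⇑f ∣[(2 : ℤ)] g) (ζB (x 0))).re)
        {x | x 0 ∈ Ioo (0 : ℝ) 1728} ∧
      c.domain = {x | x 0 < 0} ∧
      EqOn c.integrand (fun x => (djQuot (⇑f ∣[(2 : ℤ)] g) (ζC (x 0))).re) {x | x 0 < 0} ∧
      KZ.of a + KZ.of b + KZ.of c ∈ KZ.relations)
    (hP₁ : ∃ a b c : IntegralRep 1,
      a.domain = arcDomain ∧
      EqOn a.integrand (fun x => (arcIntegrand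
        (⇑f ∣[(2 : ℤ)] (g * (ModularGroup.T * ModularGroup.S))) (x 0)).re) arcDomain ∧
      b.domain = {x | x 0 ∈ Ioo (0 : ℝ) 1728} ∧
      EqOn b.integrand (fun x => (djQuot
        (⇑f ∣[(2 : ℤ)] (g * (ModularGroup.T * ModularGroup.S))) (ζB (x 0))).re)
        {x | x 0 ∈ Ioo (0 : ℝ) 1728} ∧
      c.domain = {x | x 0 < 0} ∧
      EqOn c.integrand (fun x => (djQuot
        (⇑f ∣[(2 : ℤ)] (g * (ModularGroup.T * ModularGroup.S))) (ζC (x 0))).re) {x | x 0 < 0} ∧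
      KZ.of a + KZ.of b + KZ.of c ∈ KZ.relations)
    (hP₂ : ∃ a b c : IntegralRep 1,
      a.domain = arcDomain ∧
      EqOn a.integrand (fun x => (arcIntegrand (⇑f ∣[(2 : ℤ)]
        (g * (ModularGroup.T * ModularGroup.S) * (ModularGroup.T * ModularGroup.S))) (x 0)).re)
        arcDomain ∧
      b.domain = {x | x 0 ∈ Ioo (0 : ℝ) 1728} ∧
      EqOn b.integrand (fun x => (djQuot (⇑f ∣[(2 : ℤ)]
        (g * (ModularGroup.T * ModularGroup.S) * (ModularGroup.T * ModularGroup.S)))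
        (ζB (x 0))).re) {x | x 0 ∈ Ioo (0 : ℝ) 1728} ∧
      c.domain = {x | x 0 < 0} ∧
      EqOn c.integrand (fun x => (djQuot (⇑f ∣[(2 : ℤ)]
        (g * (ModularGroup.T * ModularGroup.S) * (ModularGroup.T * ModularGroup.S)))
        (ζC (x 0))).re) {x | x 0 < 0} ∧
      KZ.of a + KZ.of b + KZ.of c ∈ KZ.relations)
    (hM₀ : ∃ a b c : IntegralRep 1,
      a.domain = arcDomain ∧
      EqOn a.integrand (fun x => (arcIntegrand (⇑f ∣[(2 : ℤ)] (g * ModularGroup.S)) (x 0)).re)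
        arcDomain ∧
      b.domain = {x | x 0 ∈ Ioo (0 : ℝ) 1728} ∧
      EqOn b.integrand (fun x => (djQuot (⇑f ∣[(2 : ℤ)] (g * ModularGroup.S))
        (ModularGroup.S • ζB (x 0))).re) {x | x 0 ∈ Ioo (0 : ℝ) 1728} ∧
      c.domain = {x | x 0 < 0} ∧
      EqOn c.integrand (fun x => (djQuot (⇑f ∣[(2 : ℤ)] (g * ModularGroup.S))
        (ModularGroup.T⁻¹ • ζC (x 0))).re) {x | x 0 < 0} ∧
      KZ.of a + KZ.of b + KZ.of c ∈ KZ.relations)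
    (hM₁ : ∃ a b c : IntegralRep 1,
      a.domain = arcDomain ∧
      EqOn a.integrand (fun x => (arcIntegrand
        (⇑f ∣[(2 : ℤ)] (g * (ModularGroup.T * ModularGroup.S) * ModularGroup.S)) (x 0)).re)
        arcDomain ∧
      b.domain = {x | x 0 ∈ Ioo (0 : ℝ) 1728} ∧
      EqOn b.integrand (fun x => (djQuot
        (⇑f ∣[(2 : ℤ)] (g * (ModularGroup.T * ModularGroup.S) * ModularGroup.S))
        (ModularGroup.S • ζB (x 0))).re) {x | x 0 ∈ Ioo (0 : ℝ) 1728} ∧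
      c.domain = {x | x 0 < 0} ∧
      EqOn c.integrand (fun x => (djQuot
        (⇑f ∣[(2 : ℤ)] (g * (ModularGroup.T * ModularGroup.S) * ModularGroup.S))
        (ModularGroup.T⁻¹ • ζC (x 0))).re) {x | x 0 < 0} ∧
      KZ.of a + KZ.of b + KZ.of c ∈ KZ.relations)
    (hM₂ : ∃ a b c : IntegralRep 1,
      a.domain = arcDomain ∧
      EqOn a.integrand (fun x => (arcIntegrand (⇑f ∣[(2 : ℤ)]
        (g * (ModularGroup.T * ModularGroup.S) * (ModularGroup.T * ModularGroup.S) *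
          ModularGroup.S)) (x 0)).re) arcDomain ∧
      b.domain = {x | x 0 ∈ Ioo (0 : ℝ) 1728} ∧
      EqOn b.integrand (fun x => (djQuot (⇑f ∣[(2 : ℤ)]
        (g * (ModularGroup.T * ModularGroup.S) * (ModularGroup.T * ModularGroup.S) *
          ModularGroup.S)) (ModularGroup.S • ζB (x 0))).re) {x | x 0 ∈ Ioo (0 : ℝ) 1728} ∧
      c.domain = {x | x 0 < 0} ∧
      EqOn c.integrand (fun x => (djQuot (⇑f ∣[(2 : ℤ)]
        (g * (ModularGroup.T * ModularGroup.S) * (ModularGroup.T * ModularGroup.S) *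
          ModularGroup.S)) (ModularGroup.T⁻¹ • ζC (x 0))).re) {x | x 0 < 0} ∧
      KZ.of a + KZ.of b + KZ.of c ∈ KZ.relations) :
    ρ₀.classRe + ρ₁.classRe + ρ₂.classRe ∈ KZ.relations :=
  three_term_of_tiles Complex.re f g ζB ζC _ _ _ _ _ _ rfl (fun _ _ => rfl) rfl (fun _ _ => rfl)
    rfl (fun _ _ => rfl) rfl (fun _ _ => rfl) rfl (fun _ _ => rfl) rfl (fun _ _ => rfl)
    hP₀ hP₁ hP₂ hM₀ hM₁ hM₂

/-- **Manin's three-term relation for `classIm`, reduced to the six per-tile Cauchy relations**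
(imaginary parts; same statement and proof as `classRe_three_term_of_tiles` with `im` for `re`).
[cite: Manin1972, §1.6] -/
theorem classIm_three_term_of_tiles (f : CuspForm (Gamma0 N) 2) (g : SL(2, ℤ)) (ζB ζC : ℝ → ℍ)
    (ρ₀ : ModularSymbolRep f g) (ρ₁ : ModularSymbolRep f (g * (ModularGroup.T * ModularGroup.S)))
    (ρ₂ : ModularSymbolRep f
      (g * (ModularGroup.T * ModularGroup.S) * (ModularGroup.T * ModularGroup.S)))
    (hP₀ : ∃ a b c : IntegralRep 1,
      a.domain = arcDomain ∧
      EqOn a.integrand (fun x => (arcIntegrand (⇑f ∣[(2 : ℤ)] g) (x 0)).im) arcDomain ∧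
      b.domain = {x | x 0 ∈ Ioo (0 : ℝ) 1728} ∧
      EqOn b.integrand (fun x => (djQuot (⇑f ∣[(2 : ℤ)] g) (ζB (x 0))).im)
        {x | x 0 ∈ Ioo (0 : ℝ) 1728} ∧
      c.domain = {x | x 0 < 0} ∧
      EqOn c.integrand (fun x => (djQuot (⇑f ∣[(2 : ℤ)] g) (ζC (x 0))).im) {x | x 0 < 0} ∧
      KZ.of a + KZ.of b + KZ.of c ∈ KZ.relations)
    (hP₁ : ∃ a b c : IntegralRep 1,
      a.domain = arcDomain ∧
      EqOn a.integrand (fun x => (arcIntegrand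
        (⇑f ∣[(2 : ℤ)] (g * (ModularGroup.T * ModularGroup.S))) (x 0)).im) arcDomain ∧
      b.domain = {x | x 0 ∈ Ioo (0 : ℝ) 1728} ∧
      EqOn b.integrand (fun x => (djQuot
        (⇑f ∣[(2 : ℤ)] (g * (ModularGroup.T * ModularGroup.S))) (ζB (x 0))).im)
        {x | x 0 ∈ Ioo (0 : ℝ) 1728} ∧
      c.domain = {x | x 0 < 0} ∧
      EqOn c.integrand (fun x => (djQuot
        (⇑f ∣[(2 : ℤ)] (g * (ModularGroup.T * ModularGroup.S))) (ζC (x 0))).im) {x | x 0 < 0} ∧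
      KZ.of a + KZ.of b + KZ.of c ∈ KZ.relations)
    (hP₂ : ∃ a b c : IntegralRep 1,
      a.domain = arcDomain ∧
      EqOn a.integrand (fun x => (arcIntegrand (⇑f ∣[(2 : ℤ)]
        (g * (ModularGroup.T * ModularGroup.S) * (ModularGroup.T * ModularGroup.S))) (x 0)).im)
        arcDomain ∧
      b.domain = {x | x 0 ∈ Ioo (0 : ℝ) 1728} ∧
      EqOn b.integrand (fun x => (djQuot (⇑f ∣[(2 : ℤ)]
        (g * (ModularGroup.T * ModularGroup.S) * (ModularGroup.T * ModularGroup.S)))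
        (ζB (x 0))).im) {x | x 0 ∈ Ioo (0 : ℝ) 1728} ∧
      c.domain = {x | x 0 < 0} ∧
      EqOn c.integrand (fun x => (djQuot (⇑f ∣[(2 : ℤ)]
        (g * (ModularGroup.T * ModularGroup.S) * (ModularGroup.T * ModularGroup.S)))
        (ζC (x 0))).im) {x | x 0 < 0} ∧
      KZ.of a + KZ.of b + KZ.of c ∈ KZ.relations)
    (hM₀ : ∃ a b c : IntegralRep 1,
      a.domain = arcDomain ∧
      EqOn a.integrand (fun x => (arcIntegrand (⇑f ∣[(2 : ℤ)] (g * ModularGroup.S)) (x 0)).im)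
        arcDomain ∧
      b.domain = {x | x 0 ∈ Ioo (0 : ℝ) 1728} ∧
      EqOn b.integrand (fun x => (djQuot (⇑f ∣[(2 : ℤ)] (g * ModularGroup.S))
        (ModularGroup.S • ζB (x 0))).im) {x | x 0 ∈ Ioo (0 : ℝ) 1728} ∧
      c.domain = {x | x 0 < 0} ∧
      EqOn c.integrand (fun x => (djQuot (⇑f ∣[(2 : ℤ)] (g * ModularGroup.S))
        (ModularGroup.T⁻¹ • ζC (x 0))).im) {x | x 0 < 0} ∧
      KZ.of a + KZ.of b + KZ.of c ∈ KZ.relations)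
    (hM₁ : ∃ a b c : IntegralRep 1,
      a.domain = arcDomain ∧
      EqOn a.integrand (fun x => (arcIntegrand
        (⇑f ∣[(2 : ℤ)] (g * (ModularGroup.T * ModularGroup.S) * ModularGroup.S)) (x 0)).im)
        arcDomain ∧
      b.domain = {x | x 0 ∈ Ioo (0 : ℝ) 1728} ∧
      EqOn b.integrand (fun x => (djQuot
        (⇑f ∣[(2 : ℤ)] (g * (ModularGroup.T * ModularGroup.S) * ModularGroup.S))
        (ModularGroup.S • ζB (x 0))).im) {x | x 0 ∈ Ioo (0 : ℝ) 1728} ∧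
      c.domain = {x | x 0 < 0} ∧
      EqOn c.integrand (fun x => (djQuot
        (⇑f ∣[(2 : ℤ)] (g * (ModularGroup.T * ModularGroup.S) * ModularGroup.S))
        (ModularGroup.T⁻¹ • ζC (x 0))).im) {x | x 0 < 0} ∧
      KZ.of a + KZ.of b + KZ.of c ∈ KZ.relations)
    (hM₂ : ∃ a b c : IntegralRep 1,
      a.domain = arcDomain ∧
      EqOn a.integrand (fun x => (arcIntegrand (⇑f ∣[(2 : ℤ)]
        (g * (ModularGroup.T * ModularGroup.S) * (ModularGroup.T * ModularGroup.S) *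
          ModularGroup.S)) (x 0)).im) arcDomain ∧
      b.domain = {x | x 0 ∈ Ioo (0 : ℝ) 1728} ∧
      EqOn b.integrand (fun x => (djQuot (⇑f ∣[(2 : ℤ)]
        (g * (ModularGroup.T * ModularGroup.S) * (ModularGroup.T * ModularGroup.S) *
          ModularGroup.S)) (ModularGroup.S • ζB (x 0))).im) {x | x 0 ∈ Ioo (0 : ℝ) 1728} ∧
      c.domain = {x | x 0 < 0} ∧
      EqOn c.integrand (fun x => (djQuot (⇑f ∣[(2 : ℤ)]
        (g * (ModularGroup.T * ModularGroup.S) * (ModularGroup.T * ModularGroup.S) *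
          ModularGroup.S)) (ModularGroup.T⁻¹ • ζC (x 0))).im) {x | x 0 < 0} ∧
      KZ.of a + KZ.of b + KZ.of c ∈ KZ.relations) :
    ρ₀.classIm + ρ₁.classIm + ρ₂.classIm ∈ KZ.relations :=
  three_term_of_tiles Complex.im f g ζB ζC _ _ _ _ _ _ rfl (fun _ _ => rfl) rfl (fun _ _ => rfl)
    rfl (fun _ _ => rfl) rfl (fun _ _ => rfl) rfl (fun _ _ => rfl) rfl (fun _ _ => rfl)
    hP₀ hP₁ hP₂ hM₀ hM₁ hM₂

end Summit.KontsevichZagierPeriods.HeckeMultiplicityOne.ManinStokes
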